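import Literature.Computability.Complexity.Nondeterministic
import Literature.Computability.Complexity.CircuitClasses

/-!
# PneNP / circuit route — refutations and degeneracy witnesses

Problem `PneNP`, topic `Circuit`. Sorry-free facts recording where circuit-class statements filed on
the non-uniform (NP ⊄ P/poly) route degenerate, so that planners and provers can reuse the witnesses.

* `Summit.PneNP.Circuit.size_pos_of_isEmpty`: over an empty set of input variables every
  straight-line circuit has at least one gate (a gate-free circuit must output an input wire).
* `Summit.PneNP.Circuit.SIZE_eq_empty_of_apply_zero`: hence `SIZE s = ∅` whenever `s 0 = 0`;
  in particular `SIZE (fun n => n ^ k) = ∅` for `k ≥ 1` (`SIZE_pow_eq_empty`).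
* `Summit.PneNP.Circuit.fixedPoly_literal_iff`: the literal statement
  "`∀ k, ∃ L ∈ NP, L ∉ SIZE (fun n => n ^ k)`" collapses to its `k = 0` instance
  (`∃ L ∈ NP, L ∉ SIZE (fun _ => 1)`), i.e. carries no fixed-polynomial content; the Kannan form
  `∀ k, ∃ L ∈ NP, ∀ c, L ∉ SIZE (fun n => c * n ^ k + c)` is the intended statement
  (R. Kannan, *Circuit-size lower bounds and non-reducibility to sparse sets*, Inform. Control 55
  (1982), Thm. 2, uses `c * n ^ k + c`).

All statements are elementary consequences of the definitions in
`Literature.Computability.Complexity.{Circuit, CircuitClasses}` (Arora–Barak 2009, Def. 6.1–6.5).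
-/

namespace Summit.PneNP.Circuit

open Literature.Computability.Complexity

/-- Over an empty variable set every circuit has at least one gate: with no gates the output wire
would have to be an input variable (none exist) or a back-reference to a gate (none exist).
Consequence of Arora–Barak 2009, Def. 6.1 as formalised in `Literature.Computability.Complexity.Circuit`. [folklore] -/
theorem size_pos_of_isEmpty {ι : Type*} [IsEmpty ι] (C : Literature.Computability.Complexity.Circuit ι) : 0 < C.size := by
  by_contra h
  have h0 : C.gates.length = 0 := by
    unfold Literature.Computability.Complexity.Circuit.size at h; omega
  rcases hC : C.output with i | m
  · exact isEmptyElim i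
  · have := C.wf_output m hC
    omega

/-- `SIZE s` is empty as soon as the size bound at length `0` is `0`: the family member `C 0` is a
circuit on `Fin 0` variables and needs at least one (constant) gate. [folklore] -/
theorem SIZE_eq_empty_of_apply_zero {s : ℕ → ℕ} (hs : s 0 = 0) : SIZE s = ∅ := by
  ext L
  simp only [SIZE, Set.mem_setOf_eq, Set.mem_empty_iff_false, iff_false, not_exists, not_and]
  intro C hC _
  have h := (hC 0).2
  rw [hs, Nat.le_zero] at h
  have := size_pos_of_isEmpty (C 0)
  omega

/-- `SIZE (fun n => n ^ k) = ∅` for every `k ≥ 1` (the bound at `n = 0` is `0 ^ k = 0` gates).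
Degeneracy witness for the literal fixed-polynomial statement `NP ⊄ SIZE(n^k)`. [folklore] -/
theorem SIZE_pow_eq_empty {k : ℕ} (hk : 1 ≤ k) : SIZE (fun n => n ^ k) = ∅ :=
  SIZE_eq_empty_of_apply_zero (Nat.zero_pow (by omega))

/-- For `k ≥ 1` the literal statement `∃ L ∈ NP, L ∉ SIZE (fun n => n ^ k)` is equivalent to mere
nonemptiness of `NP`. [folklore] -/
theorem exists_mem_NP_notMem_SIZE_pow_iff {k : ℕ} (hk : 1 ≤ k) :
    (∃ L ∈ Literature.Computability.Complexity.Nondeterministic.NP, L ∉ Literature.Computability.Complexity.SIZE (fun n => n ^ k)) ↔ Literature.Computability.Complexity.Nondeterministic.NP.Nonempty := by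
  rw [SIZE_pow_eq_empty hk]
  simp [Set.Nonempty]

/-- The literal fixed-polynomial statement `∀ k, ∃ L ∈ NP, L ∉ SIZE (fun n => n ^ k)` collapses to
its `k = 0` instance `∃ L ∈ NP, L ∉ SIZE (fun _ => 1)` (some NP language needs two `B₂`-gates at
some length); the instances `k ≥ 1` only assert `NP ≠ ∅`. The intended statement is Kannan's form
with bound `c * n ^ k + c`. [folklore] -/
theorem fixedPoly_literal_iff :
    (∀ k : ℕ, ∃ L ∈ Literature.Computability.Complexity.Nondeterministic.NP, L ∉ Literature.Computability.Complexity.SIZE (fun n => n ^ k)) ↔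
      ∃ L ∈ Literature.Computability.Complexity.Nondeterministic.NP, L ∉ Literature.Computability.Complexity.SIZE (fun _ => 1) := by
  constructor
  · intro h
    simpa using h 0
  · rintro ⟨L, hL, hL1⟩ k
    rcases Nat.eq_zero_or_pos k with rfl | hk
    · exact ⟨L, hL, by simpa using hL1⟩
    · exact ⟨L, hL, by rw [SIZE_pow_eq_empty hk]; simp⟩

end Summit.PneNP.Circuit
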